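import Literature.Analysis.FluidPDE.Seregin2020ScaledEnergyBoundsA
import Literature.Analysis.FluidPDE.CKNEpsilonRegularityHolds
import HarnessLib

/-!
# Small `A` forces small `C + D` (the quantitative half of Seregin–Šverák's `A`-criterion)

Analysis/FluidPDE proofs file (theorems only; no definitions, no named facts), serving the
named fact `Literature.Analysis.FluidPDE.seregin_sverak_2002` (G. Seregin, V. Šverák,
*Navier–Stokes equations with lower bounds on the pressure*, Arch. Ration. Mech. Anal. **163**
(2002) 65–86, **Lemma 3.3**: there is `ε* > 0` such that `sup_{0<R<R*} A(v; z₀, R) < ε*` implies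
that `z₀` is a regular point — restated verbatim as Barker–Wang, J. Differential Equations 2023,
§3 Lemma 1; the same statement is Seregin 2006 (arXiv:math/0607537), Cor. 1.6 / Thm. 1.4 with
`G = limsup A`, `g ≤ liminf A`).

The tree proves the BOUNDED form of the underlying estimates
(`Seregin2020.scaledEnergies_bounded_of_cknAEss_le`: `A ≤ M` on `]0, r₀]` and
`E(r₀), D(r₀) < ∞` give `A + E + C + D ≤ K` below `r₀/2`). This file re-runs that iteration
keeping track of the dependence on `M`, which yields the SMALLNESS form needed for Lemma 3.3:

* `scaledEnergies_small_of_cknAEss_le` — for every `η > 0` there is `δ > 0` (absolute), and for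
  every `Λ` a ratio `ρ ∈ (0, 1]` (depending on `η, Λ` only), such that for every suitable weak
  solution (`ν = 1`, unforced) on `Q ⊇ Q_{r₀}(z)` with `E(r₀; z) + D(r₀; z) ≤ Λ` and
  `A(r; z) ≤ δ` for all `0 < r ≤ r₀` (`A = cknAEss`), one has `C(r; z) + D(r; z) ≤ η` for all
  `0 < r ≤ ρ r₀`.

Combined with a one-scale ε-regularity criterion in `C + D` (Lemarié-Rieusset 2016, Thm. 14.4,
`lemarieRieusset_epsilon_regularity_holds`) this is the `A`-criterion; the uniformity in the
centre (`ρ` depends on `Λ` and not on the solution) is what makes it usable for cylinders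
accumulating at the top of a slab:

* `ae_bound_of_cknAEss_small_uniform` — there is an absolute `δ₀ > 0`, and for every `Λ` a ratio
  `ρ` and a constant `B`, such that for a suitable weak solution (`ν = 1`, unforced) with weak
  gradient `G` entering its local energy inequality, if for every centre `z` of a set `N` the
  closed cylinder `[z.1 - r₀², z.1] × B̄(z.2, r₀)` lies in `Q`, `E(r₀; z) + D(r₀; z) ≤ Λ` and
  `A(r; z) ≤ δ₀` for `0 < r ≤ r₀`, then `|u| ≤ B/r₀` a.e. on `Q_{ρr₀/2}(z)` for every `z ∈ N`
  (Lemma 3.3 in the special case of smallness uniform in the centre).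

## The argument (as in `Seregin2020ScaledEnergyBoundsA`, with `M = δ = t⁴`)

With the absolute constants `c` (pressure decay), `c₁, c₂, c₃` (local energy bound at the top),
`C₀` (finer multiplicative inequality), the ratio `θ` (`2cθ ≤ 1/2`) and the Young parameter `s`,
the one-step inequality `Ψ(θR) ≤ Ψ(R)/2 + b₀(δ)`, `Ψ = E + D`, holds with
`b₀(δ) = δ/2 + K₁(δ) + K₂(δ)`, `K₁ ∝ δ`, `K₂ ∝ δ³`; for `δ = t⁴`, `t ≤ 1`, `b₀ ≤ c_b t⁴ =: b`.
Iterating from `r₀` (`iterate_half_le`) and choosing `N` with `2⁻ᴺ Λ ≤ b` gives `Ψ ≤ 3b` at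
`θᴶ r₀`, `J ≥ N`; monotonicity in the radius gives `E(r) ≤ 3θ⁻¹ b`, `D(r) ≤ 3θ⁻² b` for
`r ≤ θ^{N+1} r₀`, and the multiplicative inequality `C(r) ≤ C₀ δ^{3/4}(δ + E(r))^{3/4}` then
bounds `C(r) + D(r) ≤ c_fin t`, which is `≤ η` for `t = min(1, η/(c_fin + 1))`.

## References

* G. Seregin, V. Šverák, Arch. Ration. Mech. Anal. 163 (2002), Lemma 3.3. [SereginSverak2002]
* T. Barker, W. Wang, J. Differential Equations (2023) = arXiv:2111.15444, §3 Lemma 1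
  (restatement of Lemma 3.3). [BarkerWang2023]
* G. Seregin, arXiv:math/0607537, Lemma 2.1 (c), Thm. 1.4, Cor. 1.6. [Seregin2006]
* G. Seregin, Anal. Math. Phys. 10 (2020), remark after Def. 1.7. [Seregin2020]
* P. G. Lemarié-Rieusset, *The Navier–Stokes problem in the 21st century* (2016), Thm. 14.4
  (one-scale ε-regularity in `C + D`). [LemarieRieusset2016]
-/

noncomputable section

open MeasureTheory Set Function Filter Topology TopologicalSpace Metric
open scoped NNReal ENNReal RealInnerProductSpace Laplacian

namespace Literature.Analysis.FluidPDE

namespace SereginSverak2002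

open Seregin2020

/-- `((t : ℝ≥0∞) ^ 4) ^ (3/4) = t ^ 3`. [folklore] -/
theorem rpow_four_three_quarters (t : ℝ≥0∞) : (t ^ 4) ^ (3 / 4 : ℝ) = t ^ 3 := by
  rw [← ENNReal.rpow_natCast, ← ENNReal.rpow_mul, ← ENNReal.rpow_natCast]
  norm_num

/-- `((t : ℝ≥0∞) ^ 3) ^ (2/3) = t ^ 2`. [folklore] -/
theorem rpow_three_two_thirds (t : ℝ≥0∞) : (t ^ 3) ^ (2 / 3 : ℝ) = t ^ 2 := by
  rw [← ENNReal.rpow_natCast, ← ENNReal.rpow_mul, ← ENNReal.rpow_natCast]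
  norm_num

/-- `x ^ (1/(1 - 1/2)) = x ^ 2` in `ℝ≥0∞`. [folklore] -/
theorem rpow_one_div_one_sub_half (x : ℝ≥0∞) : x ^ (1 / (1 - 1 / 2 : ℝ)) = x ^ 2 := by
  rw [show (1 / (1 - 1 / 2 : ℝ)) = ((2 : ℕ) : ℝ) by norm_num, ENNReal.rpow_natCast]

/-- `x ^ (1/(1 - 3/4)) = x ^ 4` in `ℝ≥0∞`. [folklore] -/
theorem rpow_one_div_one_sub_three_quarters (x : ℝ≥0∞) : x ^ (1 / (1 - 3 / 4 : ℝ)) = x ^ 4 := by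
  rw [show (1 / (1 - 3 / 4 : ℝ)) = ((4 : ℕ) : ℝ) by norm_num, ENNReal.rpow_natCast]
set_option maxHeartbeats 400000 in -- buildfix (bf3-g26): 160k/180k FAIL, 200k PASS at accept time; line-neutral budget line
/-- **Small `A` forces small `C + D`, uniformly** (the quantitative half of Seregin–Šverák 2002,
Lemma 3.3 / Seregin 2006, Lemma 2.1 (c) with the `M`-dependence tracked). For every `η > 0`
there is `δ ∈ (0, 1]`, and for every `Λ` a ratio `ρ ∈ (0, 1]`, such that: if `(u, p)` is a
suitable weak solution of the unforced Navier–Stokes equations (`ν = 1`) on an open `Q ⊆ ℝ × ℝ³`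
with weak spatial gradient `G`, `Q_{r₀}(z) ⊆ Q`, `E(r₀; z) + D(r₀; z) ≤ Λ` and `A(r; z) ≤ δ`
for all `0 < r ≤ r₀` (`A = cknAEss`), then `C(r; z) + D(r; z) ≤ η` for all `0 < r ≤ ρ r₀`.
[cite: SereginSverak2002, Lemma 3.3 (quantitative core); Seregin2006, Lemma 2.1 (c)] -/
theorem scaledEnergies_small_of_cknAEss_le (η : ℝ≥0) (hη : 0 < η) :
    ∃ δ : ℝ≥0, 0 < δ ∧ δ ≤ 1 ∧ ∀ Λ : ℝ≥0, ∃ ρ : ℝ, 0 < ρ ∧ ρ ≤ 1 ∧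
      ∀ (Q : Opens (ℝ × EuclideanSpace ℝ (Fin 3)))
        (u : ℝ → EuclideanSpace ℝ (Fin 3) → EuclideanSpace ℝ (Fin 3))
        (p : ℝ → EuclideanSpace ℝ (Fin 3) → ℝ)
        (G : ℝ → EuclideanSpace ℝ (Fin 3) → EuclideanSpace ℝ (Fin 3) →L[ℝ] EuclideanSpace ℝ (Fin 3)),
        IsSuitableWeakSolutionOn Q 1 0 u p → HasWeakSpatialGradientOn Q u G →
        ∀ (z : ℝ × EuclideanSpace ℝ (Fin 3)) (r₀ : ℝ), 0 < r₀ →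
          parabolicCylinder r₀ z ⊆ (Q : Set (ℝ × EuclideanSpace ℝ (Fin 3))) →
          cknE r₀ z G + cknD r₀ z p ≤ Λ →
          (∀ r ∈ Ioc (0 : ℝ) r₀, cknAEss r z u ≤ δ) →
          ∀ r ∈ Ioc (0 : ℝ) (ρ * r₀), cknC r z u + cknD r z p ≤ η := by
  -- ### the absolute constants of the three estimates (as in the bounded case)
  obtain ⟨c, hc⟩ := seregin_sverak_pressure_decay_holds.ratio
  obtain ⟨c₁, c₂, c₃, HT⟩ := localEnergyBound_top
  obtain ⟨C₀, hC₀⟩ := exists_cknC_le_finer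
  obtain ⟨θ, hθ, hθhalf, hcθ2⟩ := exists_ratio_mul_le_half (2 * c)
  have hθ1 : θ ≤ 1 := hθhalf.trans (by norm_num)
  have hθlt1 : θ < 1 := lt_of_le_of_lt hθhalf (by norm_num)
  have hcθ : (c : ℝ≥0∞) * ENNReal.ofReal θ ≤ 2⁻¹ * 2⁻¹ := by
    calc (c : ℝ≥0∞) * ENNReal.ofReal θ = 2⁻¹ * (((2 * c : ℝ≥0) : ℝ≥0∞) * ENNReal.ofReal θ) := by
          push_cast
          rw [← mul_assoc, ← mul_assoc, ENNReal.inv_mul_cancel two_ne_zero ENNReal.ofNat_ne_top,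
            one_mul]
      _ ≤ 2⁻¹ * 2⁻¹ := by gcongr
  set L : ℝ≥0∞ := ENNReal.ofReal ((2 * θ)⁻¹) * c₃ with hL
  have hLtop : L ≠ ∞ := ENNReal.mul_ne_top ENNReal.ofReal_ne_top ENNReal.coe_ne_top
  set s : ℝ≥0∞ := 2⁻¹ * 2⁻¹ * (L + 1)⁻¹ with hs
  have h2i0 : (2⁻¹ : ℝ≥0∞) ≠ 0 := ENNReal.inv_ne_zero.2 ENNReal.ofNat_ne_top
  have h2it : (2⁻¹ : ℝ≥0∞) ≠ ∞ := ENNReal.inv_ne_top.2 two_ne_zero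
  have hs0 : s ≠ 0 := mul_ne_zero (mul_ne_zero h2i0 h2i0)
    (ENNReal.inv_ne_zero.2 (ENNReal.add_ne_top.2 ⟨hLtop, ENNReal.one_ne_top⟩))
  have hstop : s ≠ ∞ := ENNReal.mul_ne_top (ENNReal.mul_ne_top h2it h2it)
    (ENNReal.inv_ne_top.2 (by simp))
  have hLs : L * s ≤ 2⁻¹ * 2⁻¹ := by
    have h1 : L * (L + 1)⁻¹ ≤ 1 := by
      rw [← div_eq_mul_inv]
      exact ENNReal.div_le_of_le_mul (by rw [one_mul]; exact le_self_add)
    calc L * s = 2⁻¹ * 2⁻¹ * (L * (L + 1)⁻¹) := by rw [hs]; ring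
      _ ≤ 2⁻¹ * 2⁻¹ * 1 := by gcongr
      _ = 2⁻¹ * 2⁻¹ := mul_one _
  have hsi : s⁻¹ ≠ ∞ := ENNReal.inv_ne_top.2 hs0
  set ε : ℝ≥0∞ := 2⁻¹ * 2⁻¹ with hε
  have hε0 : ε ≠ 0 := mul_ne_zero h2i0 h2i0
  have hεtop : ε ≠ ∞ := ENNReal.mul_ne_top h2it h2it
  have hεi : ε⁻¹ ≠ ∞ := ENNReal.inv_ne_top.2 hε0
  -- ### the δ-independent coefficients
  set A₁ : ℝ≥0∞ := ENNReal.ofReal ((2 * θ)⁻¹) * c₁ with hA₁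
  set A₂ : ℝ≥0∞ := ENNReal.ofReal ((2 * θ)⁻¹) * (c₂ + c₃ * s⁻¹ ^ 2) +
    c * ENNReal.ofReal (θ⁻¹ ^ 2) with hA₂
  have hA₁top : A₁ ≠ ∞ := ENNReal.mul_ne_top ENNReal.ofReal_ne_top ENNReal.coe_ne_top
  have hA₂top : A₂ ≠ ∞ := by
    refine ENNReal.add_ne_top.2 ⟨?_, ?_⟩
    · exact ENNReal.mul_ne_top ENNReal.ofReal_ne_top (ENNReal.add_ne_top.2 ⟨ENNReal.coe_ne_top,
        ENNReal.mul_ne_top ENNReal.coe_ne_top (ENNReal.pow_ne_top hsi)⟩)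
    · exact ENNReal.mul_ne_top ENNReal.coe_ne_top ENNReal.ofReal_ne_top
  set e₁ : ℝ≥0∞ := ε⁻¹ ^ (1 / 2 : ℝ) with he₁
  set e₂ : ℝ≥0∞ := ε⁻¹ ^ (3 / 4 : ℝ) with he₂
  have he₁top : e₁ ≠ ∞ := ENNReal.rpow_ne_top_of_nonneg (by norm_num) hεi
  have he₂top : e₂ ≠ ∞ := ENNReal.rpow_ne_top_of_nonneg (by norm_num) hεi
  set C₀' : ℝ≥0∞ := (C₀ : ℝ≥0∞) ^ (2 / 3 : ℝ) with hC₀'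
  have hC₀'top : C₀' ≠ ∞ := ENNReal.rpow_ne_top_of_nonneg (by norm_num) ENNReal.coe_ne_top
  set k₁ : ℝ≥0∞ := (A₁ * C₀' * e₁) ^ 2 with hk₁
  set k₂ : ℝ≥0∞ := (A₂ * C₀ * e₂) ^ 4 with hk₂
  have hk₁top : k₁ ≠ ∞ := ENNReal.pow_ne_top
    (ENNReal.mul_ne_top (ENNReal.mul_ne_top hA₁top hC₀'top) he₁top)
  have hk₂top : k₂ ≠ ∞ := ENNReal.pow_ne_top
    (ENNReal.mul_ne_top (ENNReal.mul_ne_top hA₂top ENNReal.coe_ne_top) he₂top)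
  set cb : ℝ≥0∞ := 2⁻¹ + k₁ + k₂ with hcb
  have hcbtop : cb ≠ ∞ := ENNReal.add_ne_top.2 ⟨ENNReal.add_ne_top.2 ⟨h2it, hk₁top⟩, hk₂top⟩
  set Θ : ℝ≥0∞ := ENNReal.ofReal θ⁻¹ with hΘ
  have hΘtop : Θ ≠ ∞ := ENNReal.ofReal_ne_top
  set cfin : ℝ≥0∞ := (C₀ : ℝ≥0∞) * (1 + 3 * Θ * cb) ^ (3 / 4 : ℝ) + 3 * Θ ^ 2 * cb with hcfin
  have hcfintop : cfin ≠ ∞ := by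
    refine ENNReal.add_ne_top.2 ⟨ENNReal.mul_ne_top ENNReal.coe_ne_top
      (ENNReal.rpow_ne_top_of_nonneg (by norm_num) (ENNReal.add_ne_top.2 ⟨ENNReal.one_ne_top,
        ENNReal.mul_ne_top (ENNReal.mul_ne_top (by simp) hΘtop) hcbtop⟩)), ?_⟩
    exact ENNReal.mul_ne_top (ENNReal.mul_ne_top (by simp) (ENNReal.pow_ne_top hΘtop)) hcbtop
  -- ### the choice of `t` and `δ = t⁴`
  set cf : ℝ≥0 := cfin.toNNReal with hcf
  have hcf' : cfin = (cf : ℝ≥0∞) := (ENNReal.coe_toNNReal hcfintop).symm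
  set t : ℝ≥0 := min 1 (η / (cf + 1)) with ht
  have ht1 : t ≤ 1 := min_le_left _ _
  have ht0 : 0 < t := lt_min one_pos (div_pos hη (by positivity))
  have hcft : cfin * (t : ℝ≥0∞) ≤ η := by
    rw [hcf', ← ENNReal.coe_mul, ENNReal.coe_le_coe, ← NNReal.coe_le_coe]
    have hcf0 : (0 : ℝ) ≤ cf := cf.coe_nonneg
    have hη0 : (0 : ℝ) ≤ η := η.coe_nonneg
    have htle : (t : ℝ) ≤ η / (cf + 1) := by exact_mod_cast min_le_right (1 : ℝ≥0) (η / (cf + 1))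
    push_cast
    calc (cf : ℝ) * t ≤ cf * (η / (cf + 1)) := by gcongr
      _ ≤ η := by
          rw [mul_div_assoc', div_le_iff₀ (by positivity)]
          nlinarith
  set δ : ℝ≥0 := t ^ 4 with hδ
  have hδ0 : 0 < δ := pow_pos ht0 4
  have hδ1 : δ ≤ 1 := pow_le_one₀ t.coe_nonneg ht1 |> fun h => by exact_mod_cast h
  have hδt : (δ : ℝ≥0∞) = (t : ℝ≥0∞) ^ 4 := by rw [hδ, ENNReal.coe_pow]
  have httop : (t : ℝ≥0∞) ≠ ∞ := ENNReal.coe_ne_top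
  have ht1' : (t : ℝ≥0∞) ≤ 1 := by exact_mod_cast ht1
  -- the constants of the bounded case with `M = δ`
  set γ : ℝ≥0∞ := (C₀ : ℝ≥0∞) * (δ : ℝ≥0∞) ^ (3 / 4 : ℝ) with hγ
  have hγt : γ = (C₀ : ℝ≥0∞) * (t : ℝ≥0∞) ^ 3 := by rw [hγ, hδt, rpow_four_three_quarters]
  have hγtop : γ ≠ ∞ := by rw [hγt]; exact ENNReal.mul_ne_top ENNReal.coe_ne_top (ENNReal.pow_ne_top httop)
  set α₁ : ℝ≥0∞ := A₁ * γ ^ (2 / 3 : ℝ) with hα₁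
  set α₂ : ℝ≥0∞ := A₂ * γ with hα₂
  have hα₁t : α₁ = A₁ * C₀' * (t : ℝ≥0∞) ^ 2 := by
    rw [hα₁, hγt, ENNReal.mul_rpow_of_nonneg _ _ (by norm_num), rpow_three_two_thirds, hC₀']
    ring
  have hα₂t : α₂ = A₂ * C₀ * (t : ℝ≥0∞) ^ 3 := by rw [hα₂, hγt, mul_assoc]
  set K₁ : ℝ≥0∞ := (α₁ * ε⁻¹ ^ (1 / 2 : ℝ)) ^ (1 / (1 - 1 / 2 : ℝ)) with hK₁
  set K₂ : ℝ≥0∞ := (α₂ * ε⁻¹ ^ (3 / 4 : ℝ)) ^ (1 / (1 - 3 / 4 : ℝ)) with hK₂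
  have hK₁t : K₁ = k₁ * (t : ℝ≥0∞) ^ 4 := by
    rw [hK₁, rpow_one_div_one_sub_half, hα₁t, hk₁, ← he₁]
    ring
  have hK₂t : K₂ = k₂ * (t : ℝ≥0∞) ^ 12 := by
    rw [hK₂, rpow_one_div_one_sub_three_quarters, hα₂t, hk₂, ← he₂]
    ring
  set b₀ : ℝ≥0∞ := 2⁻¹ * (δ : ℝ≥0∞) + K₁ + K₂ with hb₀
  set b : ℝ≥0∞ := cb * (t : ℝ≥0∞) ^ 4 with hb
  have hb₀b : b₀ ≤ b := by
    have h12 : (t : ℝ≥0∞) ^ 12 ≤ (t : ℝ≥0∞) ^ 4 := pow_le_pow_right_of_le_one' ht1' (by norm_num)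
    calc b₀ = 2⁻¹ * (t : ℝ≥0∞) ^ 4 + k₁ * (t : ℝ≥0∞) ^ 4 + k₂ * (t : ℝ≥0∞) ^ 12 := by
          rw [hb₀, hδt, hK₁t, hK₂t]
      _ ≤ 2⁻¹ * (t : ℝ≥0∞) ^ 4 + k₁ * (t : ℝ≥0∞) ^ 4 + k₂ * (t : ℝ≥0∞) ^ 4 := by gcongr
      _ = b := by rw [hb, hcb]; ring
  have hbtop : b ≠ ∞ := ENNReal.mul_ne_top hcbtop (ENNReal.pow_ne_top httop)
  have hbpos : 0 < b := by
    refine lt_of_lt_of_le ?_ hb₀b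
    rw [hb₀]
    refine lt_of_lt_of_le ?_ (le_self_add.trans le_self_add)
    exact ENNReal.mul_pos h2i0 (by exact_mod_cast hδ0.ne')
  refine ⟨δ, hδ0, hδ1, fun Λ => ?_⟩
  -- ### the number of iterations `N` with `2⁻ᴺ Λ < b`, and the ratio `ρ = θ^{N+1}`
  have hlim : Tendsto (fun n : ℕ => (2⁻¹ : ℝ≥0∞) ^ n * Λ) atTop (𝓝 0) := by
    have h := ENNReal.Tendsto.mul_const (ENNReal.tendsto_pow_atTop_nhds_zero_of_lt_one
      (by norm_num : (2⁻¹ : ℝ≥0∞) < 1)) (Or.inr ENNReal.coe_ne_top : (0 : ℝ≥0∞) ≠ 0 ∨ (Λ : ℝ≥0∞) ≠ ∞)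
    simpa using h
  obtain ⟨N, hN⟩ := (hlim.eventually (gt_mem_nhds hbpos)).exists
  refine ⟨θ ^ (N + 1), by positivity, pow_le_one₀ hθ.le hθ1, ?_⟩
  intro Q u p G hsw hG z r₀ hr₀ hQ hΛ hA r hr
  -- ### finiteness of `E`, `D` below `r₀`
  have hE₀ : cknE r₀ z G ≠ ∞ := ne_top_of_le_ne_top ENNReal.coe_ne_top (le_self_add.trans hΛ)
  have hD₀ : cknD r₀ z p ≠ ∞ := ne_top_of_le_ne_top ENNReal.coe_ne_top (le_add_self.trans hΛ)
  have hEfin : ∀ R ∈ Ioc (0 : ℝ) r₀, cknE R z G ≠ ∞ := fun R hR =>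
    ne_top_of_le_ne_top (ENNReal.mul_ne_top ENNReal.ofReal_ne_top hE₀)
      (cknE_le_mul_of_subset hr₀ hR.1 (parabolicCylinder_mono hR.1.le hR.2 z) G)
  -- ### the majorant of `C`
  have hCR : ∀ R ∈ Ioc (0 : ℝ) r₀, cknC R z u ≤ γ * (δ + cknE R z G) ^ (3 / 4 : ℝ) := by
    intro R hR
    have hQR : parabolicCylinder R z ⊆ (Q : Set (ℝ × EuclideanSpace ℝ (Fin 3))) :=
      (parabolicCylinder_mono hR.1.le hR.2 z).trans hQ
    have hGR : HasWeakSpatialGradientOn (parabolicCylinderOpens R z) u G :=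
      hG.mono (fun w hw => hQR hw)
    have hAR : cknAEss R z u ≤ δ := hA R hR
    have key := hC₀ u G z R hR.1 hGR (ne_top_of_le_ne_top ENNReal.coe_ne_top hAR) (hEfin R hR)
    calc cknC R z u ≤ C₀ * cknAEss R z u ^ (3 / 4 : ℝ) * (cknAEss R z u + cknE R z G) ^ (3 / 4 : ℝ) :=
          key
      _ ≤ C₀ * (δ : ℝ≥0∞) ^ (3 / 4 : ℝ) * (δ + cknE R z G) ^ (3 / 4 : ℝ) := by gcongr
      _ = γ * (δ + cknE R z G) ^ (3 / 4 : ℝ) := by rw [hγ]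
  have hCR23 : ∀ R ∈ Ioc (0 : ℝ) r₀,
      cknC R z u ^ (2 / 3 : ℝ) ≤ γ ^ (2 / 3 : ℝ) * (δ + cknE R z G) ^ (1 / 2 : ℝ) := by
    intro R hR
    calc cknC R z u ^ (2 / 3 : ℝ) ≤ (γ * (δ + cknE R z G) ^ (3 / 4 : ℝ)) ^ (2 / 3 : ℝ) :=
          ENNReal.rpow_le_rpow (hCR R hR) (by norm_num)
      _ = γ ^ (2 / 3 : ℝ) * (δ + cknE R z G) ^ (1 / 2 : ℝ) := by
          rw [ENNReal.mul_rpow_of_nonneg _ _ (by norm_num), ← ENNReal.rpow_mul]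
          norm_num
  -- ### the one-step inequality for `Ψ = E + D` (verbatim from the bounded case, `M = δ`)
  have step : ∀ R, 0 < R → R ≤ r₀ →
      cknE (θ * R) z G + cknD (θ * R) z p ≤ (cknE R z G + cknD R z p) / 2 + b := by
    intro R hR0 hRr
    have hR : R ∈ Ioc (0 : ℝ) r₀ := ⟨hR0, hRr⟩
    have hQR : parabolicCylinder R z ⊆ (Q : Set (ℝ × EuclideanSpace ℝ (Fin 3))) :=
      (parabolicCylinder_mono hR0.le hRr z).trans hQ
    set EE := cknE R z G with hEE
    set D := cknD R z p with hDdef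
    set C := cknC R z u with hCdef
    set X := (δ : ℝ≥0∞) + EE with hX
    have hE1 : cknE (θ * R) z G ≤ ENNReal.ofReal ((2 * θ)⁻¹) *
        (c₁ * C ^ (2 / 3 : ℝ) + c₂ * C + c₃ * (D ^ (2 / 3 : ℝ) * C ^ (1 / 3 : ℝ))) := by
      have hsub : parabolicCylinder (θ * R) z ⊆ parabolicCylinder (R / 2) z :=
        parabolicCylinder_mono (by positivity) (by nlinarith) z
      have hmono := cknE_le_mul_of_subset (half_pos hR0) (mul_pos hθ hR0) hsub G
      have e1 : R / 2 / (θ * R) = (2 * θ)⁻¹ := by field_simp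
      rw [e1] at hmono
      have hT := HT Q u p G hsw hG z R hR0 hQR
      calc cknE (θ * R) z G ≤ ENNReal.ofReal ((2 * θ)⁻¹) * cknE (R / 2) z G := hmono
        _ ≤ ENNReal.ofReal ((2 * θ)⁻¹) * (cknAEss (R / 2) z u + cknE (R / 2) z G) := by
            gcongr; exact le_add_self
        _ ≤ _ := by gcongr
    have hD1 : cknD (θ * R) z p ≤
        c * (ENNReal.ofReal θ * D + ENNReal.ofReal ((θ⁻¹) ^ 2) * C) :=
      hc Q u p hsw.distributional z R θ hR0 hθ hθ1 hQR
    have hY : D ^ (2 / 3 : ℝ) * C ^ (1 / 3 : ℝ) ≤ s * D + s⁻¹ ^ 2 * C :=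
      rpow_two_thirds_mul_rpow_one_third_le D C hs0 hstop
    have hab1 : α₁ * X ^ (1 / 2 : ℝ) ≤ ε * X + K₁ :=
      rpow_le_mul_add (by norm_num) (by norm_num) α₁ X hε0 hεtop
    have hab2 : α₂ * X ^ (3 / 4 : ℝ) ≤ ε * X + K₂ :=
      rpow_le_mul_add (by norm_num) (by norm_num) α₂ X hε0 hεtop
    calc cknE (θ * R) z G + cknD (θ * R) z p
        ≤ ENNReal.ofReal ((2 * θ)⁻¹) *
            (c₁ * C ^ (2 / 3 : ℝ) + c₂ * C + c₃ * (s * D + s⁻¹ ^ 2 * C)) +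
          c * (ENNReal.ofReal θ * D + ENNReal.ofReal ((θ⁻¹) ^ 2) * C) := by
          gcongr
          exact hE1.trans (by gcongr)
      _ = (L * s) * D + (c * ENNReal.ofReal θ) * D +
          ENNReal.ofReal ((2 * θ)⁻¹) * c₁ * C ^ (2 / 3 : ℝ) +
          (ENNReal.ofReal ((2 * θ)⁻¹) * (c₂ + c₃ * s⁻¹ ^ 2) + c * ENNReal.ofReal (θ⁻¹ ^ 2)) * C := by
          rw [hL]; ring
      _ ≤ (2⁻¹ * 2⁻¹) * D + (2⁻¹ * 2⁻¹) * D +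
          ENNReal.ofReal ((2 * θ)⁻¹) * c₁ * (γ ^ (2 / 3 : ℝ) * X ^ (1 / 2 : ℝ)) +
          (ENNReal.ofReal ((2 * θ)⁻¹) * (c₂ + c₃ * s⁻¹ ^ 2) + c * ENNReal.ofReal (θ⁻¹ ^ 2)) *
            (γ * X ^ (3 / 4 : ℝ)) := by
          gcongr
          · exact hCR23 R hR
          · exact hCR R hR
      _ = 2⁻¹ * D + α₁ * X ^ (1 / 2 : ℝ) + α₂ * X ^ (3 / 4 : ℝ) := by
          rw [quarter_add_quarter, hα₁, hα₂, hA₁, hA₂]; ring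
      _ ≤ 2⁻¹ * D + (ε * X + K₁) + (ε * X + K₂) := by gcongr
      _ = 2⁻¹ * D + 2⁻¹ * X + K₁ + K₂ := by
          rw [hε, ← quarter_add_quarter X]; ring
      _ = (EE + D) / 2 + b₀ := by
          rw [hX, hb₀, div_eq_mul_inv]; ring
      _ ≤ (EE + D) / 2 + b := by gcongr
  -- ### the iteration: `Ψ(θᴶ r₀) ≤ 3 b` for `J ≥ N`
  have hiter : ∀ J : ℕ, N ≤ J → cknE (θ ^ J * r₀) z G + cknD (θ ^ J * r₀) z p ≤ 3 * b := by
    intro J hJ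
    have := iterate_half_le (φ := fun ρ' => cknE ρ' z G + cknD ρ' z p) hθ hθ1 hr₀ step J
    refine this.trans ?_
    have h2 : (2⁻¹ : ℝ≥0∞) ^ J * (cknE r₀ z G + cknD r₀ z p) ≤ b := by
      calc (2⁻¹ : ℝ≥0∞) ^ J * (cknE r₀ z G + cknD r₀ z p)
          ≤ (2⁻¹ : ℝ≥0∞) ^ N * (cknE r₀ z G + cknD r₀ z p) :=
            mul_le_mul_left (pow_le_pow_right_of_le_one' (ENNReal.inv_le_one.2 one_le_two) hJ) _
        _ ≤ (2⁻¹ : ℝ≥0∞) ^ N * Λ := mul_le_mul_right hΛ _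
        _ ≤ b := hN.le
    calc 2 * b + (2⁻¹ : ℝ≥0∞) ^ J * (cknE r₀ z G + cknD r₀ z p) ≤ 2 * b + b := by gcongr
      _ = 3 * b := by ring
  -- ### the scale `θᴶ r₀` enclosing `r`, with `J ≥ N`
  have hrpos : 0 < r := hr.1
  have hρ1 : θ ^ (N + 1) ≤ 1 := pow_le_one₀ hθ.le hθ1
  have hrr₀ : r ≤ r₀ := hr.2.trans (by nlinarith)
  obtain ⟨J, hJ1, hJ2⟩ := exists_nat_pow_near_of_lt_one (div_pos hrpos hr₀)
    ((div_le_one hr₀).2 hrr₀) hθ hθlt1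
  have hle : r ≤ θ ^ J * r₀ := by rwa [div_le_iff₀ hr₀] at hJ2
  have hNJ : N ≤ J := by
    have h1 : θ ^ (J + 1) < θ ^ (N + 1) := by
      refine lt_of_lt_of_le hJ1 ?_
      rw [div_le_iff₀ hr₀]
      exact hr.2
    have := (pow_lt_pow_iff_right_of_lt_one₀ hθ hθlt1).1 h1
    omega
  have hJr₀ : θ ^ J * r₀ ∈ Ioc (0 : ℝ) r₀ :=
    ⟨by positivity, by nlinarith [pow_le_one₀ hθ.le hθ1 (n := J)]⟩
  have hlt : θ ^ J * r₀ < θ⁻¹ * r := by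
    rw [lt_div_iff₀ hr₀] at hJ1
    have : θ ^ J * r₀ = θ⁻¹ * (θ ^ (J + 1) * r₀) := by
      rw [pow_succ]; field_simp
    rw [this]
    exact mul_lt_mul_of_pos_left hJ1 (inv_pos.2 hθ)
  have hratio : θ ^ J * r₀ / r ≤ θ⁻¹ := (div_le_iff₀ hrpos).2 hlt.le
  have hsub : parabolicCylinder r z ⊆ parabolicCylinder (θ ^ J * r₀) z :=
    parabolicCylinder_mono hrpos.le hle z
  have hΨJ := hiter J hNJ
  -- ### `E(r)`, `D(r)`, `C(r)`
  have hEr : cknE r z G ≤ Θ * (3 * b) := by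
    calc cknE r z G ≤ ENNReal.ofReal (θ ^ J * r₀ / r) * cknE (θ ^ J * r₀) z G :=
          cknE_le_mul_of_subset (by positivity) hrpos hsub G
      _ ≤ Θ * (3 * b) := by
          rw [hΘ]
          gcongr
          exact le_self_add.trans hΨJ
  have hDr : cknD r z p ≤ Θ ^ 2 * (3 * b) := by
    calc cknD r z p ≤ ENNReal.ofReal (θ ^ J * r₀ / r) ^ 2 * cknD (θ ^ J * r₀) z p :=
          cknD_le_mul_of_subset (by positivity) hrpos hsub p
      _ ≤ Θ ^ 2 * (3 * b) := by
          rw [hΘ]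
          gcongr
          exact le_add_self.trans hΨJ
  have hCr : cknC r z u ≤ (C₀ : ℝ≥0∞) * (1 + 3 * Θ * cb) ^ (3 / 4 : ℝ) * (t : ℝ≥0∞) ^ 6 := by
    have h1 := hCR r ⟨hrpos, hrr₀⟩
    have h2 : (δ : ℝ≥0∞) + cknE r z G ≤ (1 + 3 * Θ * cb) * (t : ℝ≥0∞) ^ 4 := by
      calc (δ : ℝ≥0∞) + cknE r z G ≤ (t : ℝ≥0∞) ^ 4 + Θ * (3 * (cb * (t : ℝ≥0∞) ^ 4)) := by
            rw [hδt]; gcongr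
        _ = (1 + 3 * Θ * cb) * (t : ℝ≥0∞) ^ 4 := by ring
    calc cknC r z u ≤ γ * ((δ : ℝ≥0∞) + cknE r z G) ^ (3 / 4 : ℝ) := h1
      _ ≤ γ * ((1 + 3 * Θ * cb) * (t : ℝ≥0∞) ^ 4) ^ (3 / 4 : ℝ) := by gcongr
      _ = (C₀ : ℝ≥0∞) * (1 + 3 * Θ * cb) ^ (3 / 4 : ℝ) * (t : ℝ≥0∞) ^ 6 := by
          rw [hγt, ENNReal.mul_rpow_of_nonneg _ _ (by norm_num), rpow_four_three_quarters]
          ring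
  -- ### conclusion: `C + D ≤ cfin t ≤ η`
  have ht6 : (t : ℝ≥0∞) ^ 6 ≤ (t : ℝ≥0∞) ^ 1 := pow_le_pow_right_of_le_one' ht1' (by norm_num)
  have ht4 : (t : ℝ≥0∞) ^ 4 ≤ (t : ℝ≥0∞) ^ 1 := pow_le_pow_right_of_le_one' ht1' (by norm_num)
  rw [pow_one] at ht6 ht4
  calc cknC r z u + cknD r z p
      ≤ (C₀ : ℝ≥0∞) * (1 + 3 * Θ * cb) ^ (3 / 4 : ℝ) * (t : ℝ≥0∞) ^ 6 + Θ ^ 2 * (3 * b) :=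
        add_le_add hCr hDr
    _ = (C₀ : ℝ≥0∞) * (1 + 3 * Θ * cb) ^ (3 / 4 : ℝ) * (t : ℝ≥0∞) ^ 6 +
          3 * Θ ^ 2 * cb * (t : ℝ≥0∞) ^ 4 := by rw [hb]; ring
    _ ≤ (C₀ : ℝ≥0∞) * (1 + 3 * Θ * cb) ^ (3 / 4 : ℝ) * (t : ℝ≥0∞) +
          3 * Θ ^ 2 * cb * (t : ℝ≥0∞) := by gcongr
    _ = cfin * (t : ℝ≥0∞) := by rw [hcfin]; ring
    _ ≤ η := hcft


/-- **The uniform `A`-criterion** (Seregin–Šverák 2002, Lemma 3.3, in the special case where the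
smallness of `A` holds at every centre of a set `N`, with a bound uniform on `N`). There is an
absolute `δ₀ > 0`, and for every `Λ` a ratio `ρ ∈ (0, 1]` and a constant `B`, such that: if
`(u, p)` is a suitable weak solution of the unforced Navier–Stokes equations (`ν = 1`) on an open
`Q ⊆ ℝ × ℝ³` with weak spatial gradient `G` entering its local energy inequality, `r₀ > 0`, and
for every centre `z ∈ N` the closed cylinder `[z.1 - r₀², z.1] × B̄(z.2, r₀)` lies in `Q`,
`E(r₀; z) + D(r₀; z) ≤ Λ` and `A(r; z) ≤ δ₀` for all `0 < r ≤ r₀`, then `|u| ≤ B / r₀` a.e. on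
`Q_{ρ r₀ / 2}(z)` for every `z ∈ N`. Proof: `scaledEnergies_small_of_cknAEss_le` with `η = ε₀³`,
`ε₀` the threshold of Lemarié-Rieusset's Thm. 14.4 for `ν = 1`, `q = 3`
(`lemarieRieusset_epsilon_regularity_holds`), applied on the box `(z.1 - r₀², z.1) × B(z.2, r₀)`.
[cite: SereginSverak2002, Lemma 3.3 (uniform-in-centre case); LemarieRieusset2016, Thm. 14.4] -/
theorem ae_bound_of_cknAEss_small_uniform :
    ∃ δ₀ : ℝ≥0, 0 < δ₀ ∧ ∀ Λ : ℝ≥0, ∃ ρ B : ℝ, 0 < ρ ∧ ρ ≤ 1 ∧ 0 < B ∧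
      ∀ (Q : Opens (ℝ × EuclideanSpace ℝ (Fin 3)))
        (u : ℝ → EuclideanSpace ℝ (Fin 3) → EuclideanSpace ℝ (Fin 3))
        (p : ℝ → EuclideanSpace ℝ (Fin 3) → ℝ)
        (G : ℝ → EuclideanSpace ℝ (Fin 3) → EuclideanSpace ℝ (Fin 3) →L[ℝ] EuclideanSpace ℝ (Fin 3)),
        IsSuitableWeakSolutionOn Q 1 0 u p → HasWeakSpatialGradientOn Q u G →
        (∀ φ : ℝ → EuclideanSpace ℝ (Fin 3) → ℝ, IsSpaceTimeTestOn Q φ → (∀ t x, 0 ≤ φ t x) →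
          2 * (1 : ℝ) * ∫ t, ∫ x, frobeniusNormSq (G t x) * φ t x ≤
            ∫ t, ∫ x, (‖u t x‖ ^ 2 * (timeDeriv φ t x + 1 * Δ (φ t) x) +
              (‖u t x‖ ^ 2 + 2 * p t x) * ⟪u t x, gradient (φ t) x⟫ +
              2 * ⟪(0 : ℝ → EuclideanSpace ℝ (Fin 3) → EuclideanSpace ℝ (Fin 3)) t x, u t x⟫ * φ t x)) →
        ∀ (N : Set (ℝ × EuclideanSpace ℝ (Fin 3))) (r₀ : ℝ), 0 < r₀ →
          (∀ z ∈ N, Icc (z.1 - r₀ ^ 2) z.1 ×ˢ closedBall z.2 r₀ ⊆ (Q : Set (ℝ × EuclideanSpace ℝ (Fin 3)))) →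
          (∀ z ∈ N, cknE r₀ z G + cknD r₀ z p ≤ Λ) →
          (∀ z ∈ N, ∀ r ∈ Ioc (0 : ℝ) r₀, cknAEss r z u ≤ δ₀) →
          ∀ z ∈ N, ∀ᵐ w ∂(volume.restrict (parabolicCylinder (ρ * r₀ / 2) z)), ‖u w.1 w.2‖ ≤ B / r₀ := by
  -- the threshold of Thm. 14.4 for `ν = 1`, `q = 3`
  obtain ⟨ε₀, C₀, hε₀, hC₀, H⟩ :=
    (lemarieRieusset_epsilon_regularity_iff.1 lemarieRieusset_epsilon_regularity_holds) 1 3 one_pos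
      (by norm_num)
  -- the smallness `C + D ≤ ε₀³`
  set η : ℝ≥0 := (ε₀ ^ 3).toNNReal with hη
  have hη0 : 0 < η := Real.toNNReal_pos.2 (pow_pos hε₀ 3)
  have hηe : (η : ℝ≥0∞) = ENNReal.ofReal (ε₀ ^ 3) := rfl
  obtain ⟨δ, hδ0, -, Hδ⟩ := scaledEnergies_small_of_cknAEss_le η hη0
  refine ⟨δ, hδ0, fun Λ => ?_⟩
  obtain ⟨ρ, hρ0, hρ1, Hρ⟩ := Hδ Λ
  refine ⟨ρ, 2 * C₀ * ε₀ / ρ, hρ0, hρ1, by positivity, ?_⟩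
  intro Q u p G hsw hG hloc N r₀ hr₀ hK hΛ hA z hz
  set r₁ : ℝ := ρ * r₀ with hr₁
  have hr₁0 : 0 < r₁ := mul_pos hρ0 hr₀
  have hr₁r₀ : r₁ ≤ r₀ := by rw [hr₁]; nlinarith
  -- `C(r₁; z) + D(r₁; z) ≤ ε₀³`
  have hQz : parabolicCylinder r₀ z ⊆ (Q : Set (ℝ × EuclideanSpace ℝ (Fin 3))) := by
    intro w hw
    rw [mem_parabolicCylinder] at hw
    exact hK z hz ⟨⟨hw.1.1.le, hw.1.2.le⟩, mem_closedBall.2 (le_of_lt hw.2)⟩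
  have hCD := Hρ Q u p G hsw hG z r₀ hr₀ hQz (hΛ z hz) (hA z hz) r₁ ⟨hr₁0, le_rfl⟩
  -- the box `Ω = (z.1 - r₀², z.1) × B(z.2, r₀)` and its compact closure in `Q`
  let Ω : Opens (ℝ × EuclideanSpace ℝ (Fin 3)) :=
    ⟨Ioo (z.1 - r₀ ^ 2) z.1 ×ˢ ball z.2 r₀, isOpen_Ioo.prod isOpen_ball⟩
  set K : Set (ℝ × EuclideanSpace ℝ (Fin 3)) := Icc (z.1 - r₀ ^ 2) z.1 ×ˢ closedBall z.2 r₀ with hKdef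
  have hKc : IsCompact K := isCompact_Icc.prod (isCompact_closedBall _ _)
  have hΩK : (Ω : Set (ℝ × EuclideanSpace ℝ (Fin 3))) ⊆ K :=
    prod_mono Ioo_subset_Icc_self ball_subset_closedBall
  have hKQ : K ⊆ (Q : Set (ℝ × EuclideanSpace ℝ (Fin 3))) := hK z hz
  have hΩle : Ω ≤ Q := fun w hw => hKQ (hΩK hw)
  obtain ⟨G', hG', hG'2, -⟩ := hsw.localEnergy
  have hLR : IsLRSuitableWeakSolutionOn Ω 1 3 0 u p G :=
    { isConnected := (isConnected_Ioo (by nlinarith)).prod (isConnected_ball hr₀)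
      energyClass := by
        obtain ⟨C, hC⟩ := hsw.energyClass K hKQ hKc
        exact ⟨C, hC.mono fun s hs => (lintegral_mono fun y =>
          indicator_le_indicator_of_subset hΩK (fun _ => zero_le) _).trans hs⟩
      weakGradient := hG.mono hΩle
      gradient_lt_top := by
        -- `G = G'` a.e. on `Q` would do; simpler: `E(r₀; z) ≤ Λ < ∞` controls `∫∫_Ω |G|²`
        have hE : cknE r₀ z G ≠ ∞ := ne_top_of_le_ne_top ENNReal.coe_ne_top (le_self_add.trans (hΛ z hz))
        have hΩcyl : (Ω : Set (ℝ × EuclideanSpace ℝ (Fin 3))) = parabolicCylinder r₀ z := rfl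
        rw [hΩcyl]
        rw [cknE] at hE
        have hr : (ENNReal.ofReal r₀)⁻¹ ≠ 0 := ENNReal.inv_ne_zero.2 ENNReal.ofReal_ne_top
        exact lt_top_iff_ne_top.2 fun htop => hE (by rw [htop]; exact ENNReal.mul_top hr)
      pressure_lt_top := (lintegral_mono_set hΩK).trans_lt (hsw.pressure K hKQ hKc)
      force_memLp := by
        rw [uncurry_zero]
        exact MemLp.zero
      distributional := (hsw.of_le hΩle).distributional
      localEnergy := fun φ hφ hφ0 => by
        have := hloc φ (hφ.mono hΩle) hφ0
        simpa using this }
  -- Thm. 14.4 on `Q_{r₁}(z) ⊆ Ω`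
  have hcyl : parabolicCylinder r₁ z ⊆ (Ω : Set (ℝ × EuclideanSpace ℝ (Fin 3))) :=
    parabolicCylinder_mono hr₁0.le hr₁r₀ z
  have hUP : ∫⁻ w in parabolicCylinder r₁ z, (‖u w.1 w.2‖ₑ ^ (3 : ℕ) + ‖p w.1 w.2‖ₑ ^ (3 / 2 : ℝ)) ≤
      ENNReal.ofReal (ε₀ ^ 3 * r₁ ^ 2) := by
    rw [lintegral_add_left' ?_]
    swap
    · exact (hG.locallyIntegrableOn.aestronglyMeasurable.mono_measure
        (Measure.restrict_mono (hcyl.trans hΩle) le_rfl)).enorm.pow_const 3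
    have hr₁' : ENNReal.ofReal r₁ ^ 2 ≠ 0 := pow_ne_zero 2 (by simpa using hr₁0)
    have hr₁'' : ENNReal.ofReal r₁ ^ 2 ≠ ∞ := ENNReal.pow_ne_top ENNReal.ofReal_ne_top
    have e : (∫⁻ w in parabolicCylinder r₁ z, ‖u w.1 w.2‖ₑ ^ (3 : ℕ)) +
        ∫⁻ w in parabolicCylinder r₁ z, ‖p w.1 w.2‖ₑ ^ (3 / 2 : ℝ) =
        ENNReal.ofReal r₁ ^ 2 * (cknC r₁ z u + cknD r₁ z p) := by
      rw [cknC, cknD, mul_add, ← mul_assoc, ← mul_assoc, ENNReal.mul_inv_cancel hr₁' hr₁'',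
        one_mul, one_mul]
    rw [e]
    calc ENNReal.ofReal r₁ ^ 2 * (cknC r₁ z u + cknD r₁ z p) ≤ ENNReal.ofReal r₁ ^ 2 * (η : ℝ≥0∞) := by
          gcongr
      _ = ENNReal.ofReal (ε₀ ^ 3 * r₁ ^ 2) := by
          rw [hηe]
          conv_rhs => rw [ENNReal.ofReal_mul (by positivity), ENNReal.ofReal_pow hr₁0.le]
          ring
  have hF : ∫⁻ w in parabolicCylinder r₁ z,
      ‖(0 : ℝ → EuclideanSpace ℝ (Fin 3) → EuclideanSpace ℝ (Fin 3)) w.1 w.2‖ₑ ^ (3 : ℝ) ≤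
        ENNReal.ofReal (ε₀ ^ (2 * (3 : ℝ)) * r₁ ^ (5 - 3 * (3 : ℝ))) := by simp
  have key := H Ω 0 u p G hLR z r₁ ε₀ hr₁0 hcyl hε₀.le le_rfl hUP hF
  -- `C₀ ε₀ / r₁ = (C₀ ε₀ / ρ) / r₀ ≤ B / r₀`
  have hdiv : C₀ * ε₀ / r₁ ≤ 2 * C₀ * ε₀ / ρ / r₀ := by
    rw [hr₁, div_div]
    exact div_le_div_of_nonneg_right (by nlinarith [mul_pos hC₀ hε₀]) (by positivity)
  rw [show ρ * r₀ / 2 = r₁ / 2 by rw [hr₁]]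
  filter_upwards [key] with w hw
  exact hw.trans hdiv

end SereginSverak2002

end Literature.Analysis.FluidPDE

end
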